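import Literature.MathematicalPhysics.QuantumFieldTheory.Balaban1983to89.B1Cor23ZeroFieldRegion

/-!
# `Balaban1983to89.B1DeltaGCutoff` — [Balaban1983RegularityDecay] (1.11)/(2.30) second sentence: the ADAPTED CUTOFF `χ_{Ω,M}` of a region
# `Ω ⊂ T_ε` (a union of `k`-blocks) built from the lattice distance to `Ωᶜ`, with the bond-Lipschitz, block-oscillation, boundary-vanishing,
# plateau and transition-set properties that `B1DeltaGRegularRegion.deltaG_pairing_of_cutoff` takes as hypotheses

statement-level skeleton of published theorems with citation tags; proofs where landed; nothing here is a claim about the Yang–Mills mass gap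

PDF held: `paper:balaban1983-cmp89-regularity-decay` p. 573 [PDF 3] ((1.11)), p. 581 [PDF 11] L1–2 (Cor. 2.3 second sentence, verbatim — re-keyed in
v1.1, doc-only, referee note S-B1-g46-1: *"The same inequalities hold for δG_k(Ω,Ω₀,A) with the additional factor
e^{−δ₀(dist(supp f,Ωᶜ)+dist(supp f′,Ωᶜ))}"*); [Balaban1982Higgs1] = `paper:balaban1982-cmp85-higgs23-i` p. 604 ((1.3) the torus distance).

CITATION HEADER (lean-in-tree rule).  T. Bałaban, *Regularity and decay of lattice Green's functions*, Commun. Math. Phys. **89** (1983) 571–597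
[Balaban1983RegularityDecay], (1.11) p. 573, Cor. 2.3 p. 580; [Balaban1982Higgs1] (1.3) p. 604.  Cell `lit-balaban`, reader/typer seat **r14**
gen 14 (unit `lit-balaban-r14`; design note `lit-balaban-r14/DESIGN-deltaG-pairings.md`, ADDENDUM step 1–3); SKELETON rows **B1.Prop2.3 /
B1.Prop2.1** (cells: the cutoff feeding the δG pairing).  USED BY NAME: typer `HiggsLattice.Site.tdist`, `HiggsCovariancePos.Inside`,
`HiggsAveraging.blockIter`; `B1Ineq234LevelZero.{tdist_shift_le_one, tdist_comm, tdist_triangle_real}`, `B1Ineq234Concrete.tdist_self`,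
`B1Cor23ZeroFieldRegion.tdist_le_of_blockIter_eq_real`.

THE OBJECTS (this file's; the print has no cutoff — it runs a random walk; disclosed METHOD divergence serving the printed STATEMENT).
* `distTo Z z₀ x = min_{y ∈ Z} |x − y|` (lattice steps) for a nonempty site set `Z` (used with `Z = Ωᶜ`).
* `cutoff M k Z z₀ x = min{1, max{0, (distTo Z x − L^k)/(M·L^k)}}` — `0` within distance `L^k` of `Z`, `1` beyond distance `(M+1)L^k`, slope
  `1/(ML^k)` in between.
WHAT THIS FILE PROVES (kernel-checked, zero `sorry`, theorems only; axioms standard).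
* §1 `distTo_le_tdist`, `exists_distTo_eq`, `distTo_eq_zero_of_mem`, **`distTo_le_distTo_add_tdist`** (1-Lipschitz).
* §2 `cutoff_nonneg`, `cutoff_le_one`, **`abs_cutoff_sub_cutoff_le`** (`|χ x − χ x′| ≤ |x − x′|/(ML^k)`), **`abs_cutoff_bond_le`**
  (`|χ(b₊) − χ(b₋)| ≤ 1/(ML^k)`), **`abs_cutoff_block_le`** (`x_k = x′_k ⇒ |χ x − χ x′| ≤ 1/M`), `cutoff_eq_zero_of_distTo_le` (`distTo ≤ L^k ⇒
  χ = 0`), `cutoff_eq_one_of_le_distTo` (`(M+1)L^k ≤ distTo ⇒ χ = 1`), **`cutoff_boundary_bond`** (for `Z ⊇ Ωᶜ`: a bond with an endpoint outside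
  `Ω` has `χ = 0` at both ends — the `hχbd` hypothesis of `deltaG_pairing_of_cutoff` for every `Ω₀ ⊇ Ω`).
* §3 `collar0` (`T₀ = {x ∈ Ω : distTo ≤ (M+2)L^k}`), `collarBlocks` (`Y`), `transition` (`T = B^k(Y)`), `jumpBonds` (`S`);
  `inside_of_mem_jumpBonds` (hSin), `mem_jumpBonds` (hS), `mem_transition_iff` (hTY), **`mem_transition_of_cutoff_ne_one`** (hTχ),
  **`src_mem_transition_of_mem_jumpBonds`** (hTS), **`cutoff_const_off_collarBlocks`** (hY, for `Ω` a union of `k`-blocks and `Z ⊇ Ωᶜ`),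
  `distTo_le_of_mem_transition`, **`sep_of_le_distTo`** (hr/hr′ with `r = ρ − (M+3)L^k` when `supp f ⊂ {distTo Z ≥ ρ}`) — i.e. EVERY
  hypothesis of `B1DeltaGRegularRegion.deltaG_pairing_of_cutoff` (v1.1) about the cutoff is discharged for `χ = cutoff Z z₀ M k`, `κ = 1/(ML^k)`,
  `κ′ = 1/M`.
HONEST SCOPE.  (i) the final printed-shape δG theorem (plugging these into `deltaG_pairing_of_cutoff`, `e^{−δr/L^k} = e^{δ(M+3)}e^{−δρ/L^k}`)
is the successor's (mechanical) item — kept out of this file so that it does not import the pending v1.1; (ii) nothing here is specific to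
`A` or to the covariance — pure lattice geometry; (iii) NOT summit progress.
-/

noncomputable section

namespace Literature.MathematicalPhysics.QuantumFieldTheory.Balaban1983to89.B1DeltaGCutoff

open HiggsLattice HiggsAveraging HiggsCovariancePos
open B1Ineq234LevelZero (tdist_shift_le_one tdist_comm tdist_triangle_real)
open B1Ineq234Concrete (tdist_self)
open B1Cor23ZeroFieldRegion (tdist_le_of_blockIter_eq_real)

variable {P : HiggsLattice.Params} {k : ℕ}

/-! ## §1 The lattice distance to a set -/

/-- `distTo Z x = min_{y ∈ Z} |x − y|` in lattice steps of `T^{(0)} = T_ε` (torus sup-distance (1.3)). [cite: Balaban1982Higgs1, (1.3) p.604] -/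
def distTo (Z : Finset (HiggsLattice.Site P 0)) (z₀ : Z) (x : HiggsLattice.Site P 0) : ℕ :=
  Z.inf' ⟨z₀.1, z₀.2⟩ fun y => HiggsLattice.Site.tdist x y

variable (Z : Finset (HiggsLattice.Site P 0)) (z₀ : Z)

/-- `distTo Z x ≤ |x − y|` for `y ∈ Z`. [cite: Balaban1982Higgs1, (1.3) p.604] -/
theorem distTo_le_tdist (x : HiggsLattice.Site P 0) {y : HiggsLattice.Site P 0} (hy : y ∈ Z) :
    distTo Z z₀ x ≤ HiggsLattice.Site.tdist x y :=
  Finset.inf'_le _ hy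

/-- the minimum is attained. [cite: Balaban1982Higgs1, (1.3) p.604] -/
theorem exists_distTo_eq (x : HiggsLattice.Site P 0) : ∃ y ∈ Z, distTo Z z₀ x = HiggsLattice.Site.tdist x y := by
  obtain ⟨y, hy, h⟩ := Finset.exists_mem_eq_inf' ⟨z₀.1, z₀.2⟩ (fun y => HiggsLattice.Site.tdist x y)
  exact ⟨y, hy, h⟩

/-- `distTo Z x = 0` on `Z`. [cite: Balaban1982Higgs1, (1.3) p.604] -/
theorem distTo_eq_zero_of_mem {x : HiggsLattice.Site P 0} (hx : x ∈ Z) : distTo Z z₀ x = 0 :=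
  Nat.le_zero.1 ((distTo_le_tdist Z z₀ x hx).trans (le_of_eq (tdist_self x)))

/-- **1-Lipschitz**: `distTo Z x ≤ distTo Z x′ + |x − x′|`. [cite: Balaban1982Higgs1, (1.3) p.604] -/
theorem distTo_le_distTo_add_tdist (x x' : HiggsLattice.Site P 0) :
    (distTo Z z₀ x : ℝ) ≤ (distTo Z z₀ x' : ℝ) + (HiggsLattice.Site.tdist x x' : ℝ) := by
  obtain ⟨y, hy, hyeq⟩ := exists_distTo_eq Z z₀ x'
  have h1 : (distTo Z z₀ x : ℝ) ≤ (HiggsLattice.Site.tdist x y : ℝ) := by exact_mod_cast distTo_le_tdist Z z₀ x hy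
  have h2 := tdist_triangle_real x x' y
  rw [hyeq]; linarith

/-- `|distTo Z x − distTo Z x′| ≤ |x − x′|`. [cite: Balaban1982Higgs1, (1.3) p.604] -/
theorem abs_distTo_sub_le (x x' : HiggsLattice.Site P 0) :
    |(distTo Z z₀ x : ℝ) - (distTo Z z₀ x' : ℝ)| ≤ (HiggsLattice.Site.tdist x x' : ℝ) := by
  have h1 := distTo_le_distTo_add_tdist Z z₀ x x'
  have h2 := distTo_le_distTo_add_tdist Z z₀ x' x
  rw [tdist_comm x' x] at h2
  rw [abs_le]; constructor <;> linarith

/-! ## §2 The cutoff -/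

/-- **The adapted cutoff** `χ(x) = min{1, max{0, (distTo Z x − L^k)/(M·L^k)}}`. [cite: Balaban1983RegularityDecay, Cor. 2.3 p.580] -/
def cutoff (M : ℕ) (k : ℕ) (x : HiggsLattice.Site P 0) : ℝ :=
  min 1 (max 0 (((distTo Z z₀ x : ℝ) - (P.L : ℝ) ^ k) / ((M : ℝ) * (P.L : ℝ) ^ k)))

variable (M : ℕ) (k : ℕ)

/-- `0 ≤ χ`. [cite: Balaban1983RegularityDecay, Cor. 2.3 p.580] -/
theorem cutoff_nonneg (x : HiggsLattice.Site P 0) : 0 ≤ cutoff Z z₀ M k x :=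
  le_min zero_le_one (le_max_left _ _)

/-- `χ ≤ 1`. [cite: Balaban1983RegularityDecay, Cor. 2.3 p.580] -/
theorem cutoff_le_one (x : HiggsLattice.Site P 0) : cutoff Z z₀ M k x ≤ 1 :=
  min_le_left _ _

/-- **Lipschitz**: `|χ x − χ x′| ≤ |x − x′|/(M·L^k)` (`M ≥ 1`). [cite: Balaban1983RegularityDecay, Cor. 2.3 p.580] -/
theorem abs_cutoff_sub_cutoff_le (hM : 1 ≤ M) (x x' : HiggsLattice.Site P 0) :
    |cutoff Z z₀ M k x - cutoff Z z₀ M k x'| ≤ (HiggsLattice.Site.tdist x x' : ℝ) / ((M : ℝ) * (P.L : ℝ) ^ k) := by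
  have hMpos : (0 : ℝ) < (M : ℝ) * (P.L : ℝ) ^ k := by
    have : (1 : ℝ) ≤ M := by exact_mod_cast hM
    have hL : (0 : ℝ) < (P.L : ℝ) ^ k := pow_pos (by exact_mod_cast P.hL) _
    positivity
  unfold cutoff
  set a := ((distTo Z z₀ x : ℝ) - (P.L : ℝ) ^ k) / ((M : ℝ) * (P.L : ℝ) ^ k) with ha
  set a' := ((distTo Z z₀ x' : ℝ) - (P.L : ℝ) ^ k) / ((M : ℝ) * (P.L : ℝ) ^ k) with ha'
  have h1 : |min 1 (max 0 a) - min 1 (max 0 a')| ≤ |max 0 a - max 0 a'| := by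
    have := abs_min_sub_min_le_max (1 : ℝ) (max 0 a) 1 (max 0 a')
    rw [sub_self, abs_zero] at this
    exact this.trans (max_le (abs_nonneg _) le_rfl)
  have h2 : |max 0 a - max 0 a'| ≤ |a - a'| := by
    have := abs_max_sub_max_le_max (0 : ℝ) a 0 a'
    rw [sub_self, abs_zero] at this
    exact this.trans (max_le (abs_nonneg _) le_rfl)
  have h3 : |a - a'| = |(distTo Z z₀ x : ℝ) - (distTo Z z₀ x' : ℝ)| / ((M : ℝ) * (P.L : ℝ) ^ k) := by
    rw [ha, ha', ← sub_div, abs_div, abs_of_pos hMpos]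
    congr 1; ring_nf
  refine h1.trans (h2.trans ?_)
  rw [h3]
  exact div_le_div_of_nonneg_right (abs_distTo_sub_le Z z₀ x x') hMpos.le

/-- **Bond jumps**: `|χ(b₊) − χ(b₋)| ≤ 1/(M·L^k)`. [cite: Balaban1983RegularityDecay, Cor. 2.3 p.580] -/
theorem abs_cutoff_bond_le (hM : 1 ≤ M) (b : HiggsLattice.PBond P 0) :
    |cutoff Z z₀ M k b.tgt - cutoff Z z₀ M k b.src| ≤ 1 / ((M : ℝ) * (P.L : ℝ) ^ k) := by
  have hMpos : (0 : ℝ) < (M : ℝ) * (P.L : ℝ) ^ k := by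
    have : (1 : ℝ) ≤ M := by exact_mod_cast hM
    have hL : (0 : ℝ) < (P.L : ℝ) ^ k := pow_pos (by exact_mod_cast P.hL) _
    positivity
  refine (abs_cutoff_sub_cutoff_le Z z₀ M k hM b.tgt b.src).trans (div_le_div_of_nonneg_right ?_ hMpos.le)
  have h := tdist_shift_le_one b.src b.dir
  rw [tdist_comm]
  exact_mod_cast h

/-- **Block oscillation**: `x_k = x′_k ⇒ |χ x − χ x′| ≤ 1/M`. [cite: Balaban1983RegularityDecay, Cor. 2.3 p.580] -/
theorem abs_cutoff_block_le (hM : 1 ≤ M) (hk : k ≤ P.K) {x x' : HiggsLattice.Site P 0} (h : blockIter k x = blockIter k x') :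
    |cutoff Z z₀ M k x - cutoff Z z₀ M k x'| ≤ 1 / (M : ℝ) := by
  have hM' : (0 : ℝ) < M := by exact_mod_cast hM
  have hL : (0 : ℝ) < (P.L : ℝ) ^ k := pow_pos (by exact_mod_cast P.hL) _
  refine (abs_cutoff_sub_cutoff_le Z z₀ M k hM x x').trans ?_
  have h1 := tdist_le_of_blockIter_eq_real hk h
  rw [div_le_div_iff₀ (by positivity) hM', one_mul]
  calc (HiggsLattice.Site.tdist x x' : ℝ) * (M : ℝ) ≤ ((P.L : ℝ) ^ k - 1) * M :=
        mul_le_mul_of_nonneg_right h1 hM'.le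
    _ ≤ (M : ℝ) * (P.L : ℝ) ^ k := by nlinarith

/-- `distTo Z x ≤ L^k ⇒ χ x = 0`. [cite: Balaban1983RegularityDecay, Cor. 2.3 p.580] -/
theorem cutoff_eq_zero_of_distTo_le {x : HiggsLattice.Site P 0} (h : (distTo Z z₀ x : ℝ) ≤ (P.L : ℝ) ^ k) :
    cutoff Z z₀ M k x = 0 := by
  unfold cutoff
  have hden : (0 : ℝ) ≤ (M : ℝ) * (P.L : ℝ) ^ k := by positivity
  have h1 : ((distTo Z z₀ x : ℝ) - (P.L : ℝ) ^ k) / ((M : ℝ) * (P.L : ℝ) ^ k) ≤ 0 :=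
    div_nonpos_of_nonpos_of_nonneg (by linarith) hden
  rw [max_eq_left h1, min_eq_right zero_le_one]

/-- `(M+1)·L^k ≤ distTo Z x ⇒ χ x = 1` (`M ≥ 1`). [cite: Balaban1983RegularityDecay, Cor. 2.3 p.580] -/
theorem cutoff_eq_one_of_le_distTo (hM : 1 ≤ M) {x : HiggsLattice.Site P 0}
    (h : ((M : ℝ) + 1) * (P.L : ℝ) ^ k ≤ (distTo Z z₀ x : ℝ)) : cutoff Z z₀ M k x = 1 := by
  unfold cutoff
  have hMpos : (0 : ℝ) < (M : ℝ) * (P.L : ℝ) ^ k := by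
    have : (1 : ℝ) ≤ M := by exact_mod_cast hM
    have hL : (0 : ℝ) < (P.L : ℝ) ^ k := pow_pos (by exact_mod_cast P.hL) _
    positivity
  have h1 : 1 ≤ ((distTo Z z₀ x : ℝ) - (P.L : ℝ) ^ k) / ((M : ℝ) * (P.L : ℝ) ^ k) := by
    rw [le_div_iff₀ hMpos]; linarith
  rw [min_eq_left (h1.trans (le_max_right _ _))]

/-- **Boundary vanishing** (the `hχbd` hypothesis of `deltaG_pairing_of_cutoff`, for every `Ω₀`): if `Z` contains the complement of `Ω` and
`L^k ≥ 1`, then on every bond with an endpoint outside `Ω` the cutoff vanishes at BOTH ends. [cite: Balaban1983RegularityDecay, (1.11) p.573] -/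
theorem cutoff_boundary_bond (Ω : Finset (HiggsLattice.Site P 0)) (hZΩ : ∀ y, y ∉ Ω → y ∈ Z) (b : HiggsLattice.PBond P 0)
    (hb : ¬ Inside Ω b) : cutoff Z z₀ M k b.src = 0 ∧ cutoff Z z₀ M k b.tgt = 0 := by
  have hL : (1 : ℝ) ≤ (P.L : ℝ) ^ k := by exact_mod_cast Nat.one_le_pow _ _ P.hL
  have hst : (HiggsLattice.Site.tdist b.src b.tgt : ℝ) ≤ 1 := by exact_mod_cast tdist_shift_le_one b.src b.dir
  -- one endpoint is outside Ω, hence in Z, hence at distance 0; the other is at distance ≤ 1 ≤ L^k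
  have key : (distTo Z z₀ b.src : ℝ) ≤ 1 ∧ (distTo Z z₀ b.tgt : ℝ) ≤ 1 := by
    unfold Inside at hb
    by_cases hs : b.src ∈ Ω
    · have ht : b.tgt ∉ Ω := fun h => hb ⟨hs, h⟩
      have h0 : distTo Z z₀ b.tgt = 0 := distTo_eq_zero_of_mem Z z₀ (hZΩ _ ht)
      have h1 : (distTo Z z₀ b.src : ℝ) ≤ (HiggsLattice.Site.tdist b.src b.tgt : ℝ) := by
        exact_mod_cast distTo_le_tdist Z z₀ b.src (hZΩ _ ht)
      refine ⟨h1.trans hst, ?_⟩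
      rw [h0]; norm_num
    · have h0 : distTo Z z₀ b.src = 0 := distTo_eq_zero_of_mem Z z₀ (hZΩ _ hs)
      have h1 : (distTo Z z₀ b.tgt : ℝ) ≤ (HiggsLattice.Site.tdist b.tgt b.src : ℝ) := by
        exact_mod_cast distTo_le_tdist Z z₀ b.tgt (hZΩ _ hs)
      rw [tdist_comm] at h1
      refine ⟨?_, h1.trans hst⟩
      rw [h0]; norm_num
  exact ⟨cutoff_eq_zero_of_distTo_le Z z₀ M k (key.1.trans hL), cutoff_eq_zero_of_distTo_le Z z₀ M k (key.2.trans hL)⟩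

/-- `χ x ≠ 1 ⇒ distTo Z x < (M+1)L^k` (`M ≥ 1`) — membership in the transition collar. [cite: Balaban1983RegularityDecay, Cor. 2.3 p.580] -/
theorem distTo_lt_of_cutoff_ne_one (hM : 1 ≤ M) {x : HiggsLattice.Site P 0} (h : cutoff Z z₀ M k x ≠ 1) :
    (distTo Z z₀ x : ℝ) < ((M : ℝ) + 1) * (P.L : ℝ) ^ k := by
  by_contra hge
  exact h (cutoff_eq_one_of_le_distTo Z z₀ M k hM (not_lt.1 hge))

/-- `χ x ≠ 0 ⇒ L^k < distTo Z x` — in particular `x ∉ Z`. [cite: Balaban1983RegularityDecay, Cor. 2.3 p.580] -/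
theorem lt_distTo_of_cutoff_ne_zero {x : HiggsLattice.Site P 0} (h : cutoff Z z₀ M k x ≠ 0) :
    (P.L : ℝ) ^ k < (distTo Z z₀ x : ℝ) := by
  by_contra hge
  exact h (cutoff_eq_zero_of_distTo_le Z z₀ M k (not_lt.1 hge))

/-! ## §3 The transition set, its block set, the jump bonds, and the separation from a deep support -/

section Transition

variable (Ω : Finset (HiggsLattice.Site P 0))

/-- the INNER COLLAR `T₀ = {x ∈ Ω : distTo Z x ≤ (M+2)L^k}`. [cite: Balaban1983RegularityDecay, Cor. 2.3 p.580] -/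
def collar0 : Finset (HiggsLattice.Site P 0) :=
  Ω.filter fun x => (distTo Z z₀ x : ℝ) ≤ ((M : ℝ) + 2) * (P.L : ℝ) ^ k

/-- the BLOCK SET `Y` of the collar (the `k`-blocks meeting `T₀`). [cite: Balaban1983RegularityDecay, Cor. 2.3 p.580] -/
def collarBlocks : Finset (HiggsLattice.Site P k) :=
  (collar0 Z z₀ M k Ω).image (blockIter k)

open Classical in
/-- the TRANSITION SET `T = B^k(Y)` (block saturation of the collar). [cite: Balaban1983RegularityDecay, Cor. 2.3 p.580] -/
def transition : Finset (HiggsLattice.Site P 0) :=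
  Finset.univ.filter fun x => blockIter k x ∈ collarBlocks Z z₀ M k Ω

open Classical in
/-- the JUMP BONDS `S = {b ⊂ Ω : χ(b₊) ≠ χ(b₋)}`. [cite: Balaban1983RegularityDecay, Cor. 2.3 p.580] -/
def jumpBonds : Finset (HiggsLattice.PBond P 0) :=
  Finset.univ.filter fun b => Inside Ω b ∧ cutoff Z z₀ M k b.tgt ≠ cutoff Z z₀ M k b.src

/-- `S` lies inside `Ω` (hypothesis `hSin`). [cite: Balaban1983RegularityDecay, Cor. 2.3 p.580] -/
theorem inside_of_mem_jumpBonds {b : HiggsLattice.PBond P 0} (hb : b ∈ jumpBonds Z z₀ M k Ω) : Inside Ω b := by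
  classical
  exact ((Finset.mem_filter.1 hb).2).1

/-- every jumping bond of `Ω` is in `S` (hypothesis `hS`). [cite: Balaban1983RegularityDecay, Cor. 2.3 p.580] -/
theorem mem_jumpBonds {b : HiggsLattice.PBond P 0} (hb : Inside Ω b) (hj : cutoff Z z₀ M k b.tgt ≠ cutoff Z z₀ M k b.src) :
    b ∈ jumpBonds Z z₀ M k Ω := by
  classical
  exact Finset.mem_filter.2 ⟨Finset.mem_univ _, hb, hj⟩

/-- `B^k(Y) ⊆ T` (hypothesis `hTY`; here an equivalence by definition). [cite: Balaban1983RegularityDecay, Cor. 2.3 p.580] -/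
theorem mem_transition_iff (x : HiggsLattice.Site P 0) : x ∈ transition Z z₀ M k Ω ↔ blockIter k x ∈ collarBlocks Z z₀ M k Ω := by
  classical
  simp only [transition, Finset.mem_filter, Finset.mem_univ, true_and]

/-- the collar lies in `T`. [cite: Balaban1983RegularityDecay, Cor. 2.3 p.580] -/
theorem mem_transition_of_mem_collar0 {x : HiggsLattice.Site P 0} (hx : x ∈ collar0 Z z₀ M k Ω) : x ∈ transition Z z₀ M k Ω :=
  (mem_transition_iff Z z₀ M k Ω x).2 (Finset.mem_image_of_mem _ hx)

/-- `{x ∈ Ω : χ x ≠ 1} ⊆ T` (hypothesis `hTχ`; `M ≥ 1`). [cite: Balaban1983RegularityDecay, Cor. 2.3 p.580] -/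
theorem mem_transition_of_cutoff_ne_one (hM : 1 ≤ M) {x : HiggsLattice.Site P 0} (hxΩ : x ∈ Ω) (h : cutoff Z z₀ M k x ≠ 1) :
    x ∈ transition Z z₀ M k Ω := by
  refine mem_transition_of_mem_collar0 Z z₀ M k Ω (Finset.mem_filter.2 ⟨hxΩ, ?_⟩)
  have h1 := distTo_lt_of_cutoff_ne_one Z z₀ M k hM h
  have hL : (0 : ℝ) ≤ (P.L : ℝ) ^ k := pow_nonneg (Nat.cast_nonneg _) _
  nlinarith

/-- `src S ⊆ T` (hypothesis `hTS`; `M ≥ 1`). [cite: Balaban1983RegularityDecay, Cor. 2.3 p.580] -/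
theorem src_mem_transition_of_mem_jumpBonds (hM : 1 ≤ M) {b : HiggsLattice.PBond P 0} (hb : b ∈ jumpBonds Z z₀ M k Ω) :
    b.src ∈ transition Z z₀ M k Ω := by
  classical
  obtain ⟨hin, hj⟩ := (Finset.mem_filter.1 hb).2
  by_cases hs : cutoff Z z₀ M k b.src = 1
  · -- then the target is the non-plateau endpoint, one step away
    have ht : cutoff Z z₀ M k b.tgt ≠ 1 := by rw [← hs]; exact hj
    have h1 := distTo_lt_of_cutoff_ne_one Z z₀ M k hM ht
    have h2 := distTo_le_distTo_add_tdist Z z₀ b.src b.tgt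
    have h3 : (HiggsLattice.Site.tdist b.src b.tgt : ℝ) ≤ 1 := by exact_mod_cast tdist_shift_le_one b.src b.dir
    have hL : (1 : ℝ) ≤ (P.L : ℝ) ^ k := by exact_mod_cast Nat.one_le_pow _ _ P.hL
    refine mem_transition_of_mem_collar0 Z z₀ M k Ω (Finset.mem_filter.2 ⟨hin.1, ?_⟩)
    linarith
  · exact mem_transition_of_cutoff_ne_one Z z₀ M k Ω hM hin.1 hs

/-- `χ` is CONSTANT on every block outside `Y` (hypothesis `hY`; needs `Ω` a union of `k`-blocks, `Z ⊇ Ωᶜ`, `M ≥ 1`).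
[cite: Balaban1983RegularityDecay, Cor. 2.3 p.580] -/
theorem cutoff_const_off_collarBlocks (hM : 1 ≤ M)
    (hΩ : ∀ x x' : HiggsLattice.Site P 0, blockIter k x = blockIter k x' → (x ∈ Ω ↔ x' ∈ Ω)) (hZΩ : ∀ y, y ∉ Ω → y ∈ Z)
    {x x' : HiggsLattice.Site P 0} (hxx' : blockIter k x = blockIter k x') (hy : blockIter k x ∉ collarBlocks Z z₀ M k Ω) :
    cutoff Z z₀ M k x = cutoff Z z₀ M k x' := by
  have hL : (0 : ℝ) ≤ (P.L : ℝ) ^ k := pow_nonneg (Nat.cast_nonneg _) _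
  -- no point of the block is in the collar
  have hnot : ∀ t, blockIter k t = blockIter k x → t ∉ collar0 Z z₀ M k Ω := by
    intro t ht htc
    exact hy (by rw [← ht]; exact Finset.mem_image_of_mem _ htc)
  have hdeep : ∀ t, blockIter k t = blockIter k x → t ∈ Ω → cutoff Z z₀ M k t = 1 := by
    intro t ht htΩ
    have h1 : ¬ ((distTo Z z₀ t : ℝ) ≤ ((M : ℝ) + 2) * (P.L : ℝ) ^ k) := fun h => hnot t ht (Finset.mem_filter.2 ⟨htΩ, h⟩)
    refine cutoff_eq_one_of_le_distTo Z z₀ M k hM ?_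
    nlinarith [not_le.1 h1]
  have hout : ∀ t, t ∉ Ω → cutoff Z z₀ M k t = 0 := by
    intro t ht
    refine cutoff_eq_zero_of_distTo_le Z z₀ M k ?_
    rw [distTo_eq_zero_of_mem Z z₀ (hZΩ t ht)]
    exact_mod_cast Nat.zero_le _
  by_cases hx : x ∈ Ω
  · rw [hdeep x rfl hx, hdeep x' hxx'.symm ((hΩ x x' hxx').1 hx)]
  · have hx' : x' ∉ Ω := fun h => hx ((hΩ x x' hxx').2 h)
    rw [hout x hx, hout x' hx']

/-- points of `T` are within `(M+3)L^k − 1` of `Z`. [cite: Balaban1983RegularityDecay, Cor. 2.3 p.580] -/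
theorem distTo_le_of_mem_transition (hk : k ≤ P.K) {t : HiggsLattice.Site P 0} (ht : t ∈ transition Z z₀ M k Ω) :
    (distTo Z z₀ t : ℝ) ≤ ((M : ℝ) + 3) * (P.L : ℝ) ^ k - 1 := by
  classical
  rw [mem_transition_iff] at ht
  obtain ⟨t₀, ht₀, hblk⟩ := Finset.mem_image.1 ht
  have h0 : (distTo Z z₀ t₀ : ℝ) ≤ ((M : ℝ) + 2) * (P.L : ℝ) ^ k := (Finset.mem_filter.1 ht₀).2
  have h1 := distTo_le_distTo_add_tdist Z z₀ t t₀
  have h2 := tdist_le_of_blockIter_eq_real hk hblk.symm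
  linarith

/-- **Separation** (hypotheses `hr`, `hr′` with `r = ρ − (M+3)L^k`): if `distTo Z x ≥ ρ` then `|x − t| ≥ ρ − (M+3)L^k` for every `t ∈ T`.
[cite: Balaban1983RegularityDecay, Cor. 2.3 (2.30) second sentence p.580] -/
theorem sep_of_le_distTo (hk : k ≤ P.K) {ρ : ℝ} {x t : HiggsLattice.Site P 0} (hx : ρ ≤ (distTo Z z₀ x : ℝ))
    (ht : t ∈ transition Z z₀ M k Ω) :
    ρ - ((M : ℝ) + 3) * (P.L : ℝ) ^ k ≤ (HiggsLattice.Site.tdist x t : ℝ) := by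
  have h1 := distTo_le_distTo_add_tdist Z z₀ x t
  have h2 := distTo_le_of_mem_transition Z z₀ M k Ω hk ht
  linarith

end Transition

end Literature.MathematicalPhysics.QuantumFieldTheory.Balaban1983to89.B1DeltaGCutoff

end
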